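import Summits.AtomisticToContinuum.HydrodynamicLimit.Theorems.AntiMazurCoboundariesCorrectorPressureDecayTangentTightnessHolds
import Summits.AtomisticToContinuum.HydrodynamicLimit.Theorems.AntiMazurCoboundariesCorrectorPressureDecayTangentTightnessCompactness

/-!
# Tangent tightness, V: `TangentTightness` is a theorem (line `FirstLemma`, crux stmt-AtomisticToContinuum-14135)

Both Kallenberg named facts of `Literature/MathematicalPhysics/KineticTheory/PointProcessVagueCompactness.lean` (p142217) are now
DISCHARGED by tree theorems of wave-3 stub-workers of lead a1: `LaplaceFunctionalDeterminesLaw` (Lemma 12.1) by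
`stub_laplaceFunctionalDeterminesLaw` (…TangentTightnessLaplaceUniqueness.lean, p143534; discharge recorded in
…TangentTightnessHolds.lean, p144191) and `HardCoreLawsVaguelyCompact` (Lemma 16.15 / Thm 16.16 / Thm A2.3 (ii) for hard-core laws)
by `stub_hardCoreLawsVaguelyCompact` (…TangentTightnessVagueLimit.lean p142754, …TangentTightnessCountBorel.lean p143080,
…TangentTightnessCompactness.lean: sequential vague compactness of δ-separated configurations, count-measurability of vaguely
continuous maps, tent-statistics embedding into a compact metrisable space, Prokhorov there, and reconstruction). Hence the
bridge statement `TangentTightness` of the tangent frame (…KiferTangent.lean, p138873: every tangent family has, along a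
subsequence, a translation-invariant probability tangent state), posited in cycle 2 as INFRASTRUCTURE, is PROVED unconditionally;
this closes the registered stub `stub_tangentTightness : TangentTightness`.
-/

noncomputable section

namespace Summit.AtomisticToContinuum.HydrodynamicLimit.Theorems.KiferCompactification

open Literature.MathematicalPhysics.KineticTheory.PointProcess (HardCoreLawsVaguelyCompact LaplaceFunctionalDeterminesLaw)

/-- **Kallenberg's hard-core vague compactness is discharged**: the named fact `HardCoreLawsVaguelyCompact` of
`Literature/MathematicalPhysics/KineticTheory/PointProcessVagueCompactness.lean` HOLDS, by the tree theorem
`stub_hardCoreLawsVaguelyCompact`. -/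
theorem hardCoreLawsVaguelyCompact_holds : HardCoreLawsVaguelyCompact := by
  unfold HardCoreLawsVaguelyCompact
  exact stub_hardCoreLawsVaguelyCompact

/-- **`TangentTightness` holds** (registered stub `stub_tangentTightness` of line `FirstLemma`, CLOSED): tightness of tangent
families, from `stub_tangentTightnessOfCompactness` (p144191) and the discharged compactness fact. -/
theorem stub_tangentTightness : TangentTightness :=
  stub_tangentTightnessOfCompactness hardCoreLawsVaguelyCompact_holds

/-- `TangentTightness` holds (alias of `stub_tangentTightness` under the frame's naming scheme). -/
theorem tangentTightness_holds : TangentTightness :=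
  stub_tangentTightness

end Summit.AtomisticToContinuum.HydrodynamicLimit.Theorems.KiferCompactification

end
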